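import Summits.QuantumFields.BalabanUV.Beta.GAN24.StencilSlotOfE3
import Summits.QuantumFields.BalabanUV.Beta.GAN24.StencilSlotSupRate
import Summits.QuantumFields.BalabanUV.Beta.HessKerDressedStep
import Summits.QuantumFields.BalabanUV.Beta.HessKerConvCKPlug

/-!
# `BalabanUV.Beta.GAN24.StencilSlotWallPlug` — binder row G-an2-4 / (CONV-C), AFTER the K-slot AND the S-slot reduction: THE D1 WALL
# ⟺ THE IDENTIFICATION for `d = 3`, `2 ≤ Lc`, GIVEN ONLY the two located third-jet shapes («E3Shape», «E3Drift») and the second-order rows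
# `(hW, hWall)` — asym1's plug `HessKerConvCKPlug.d1Drift_JsBalOf_iff_of_convCKWall` with its K-rows DISCHARGED by road P1
# (`KSlotAssembly.convCKWall_holds`) and its S-rows SUPPLIED by the row owner's S-slot ENDs (`StencilSlotOfE3.hS_of_e3` ∕ `hSall_of_e3`).

NOT IN PRINT; OUR PROOF ATTEMPT (row G-an2-4, owner b2b-balaban-gan24-p1; this consumer-side plug written by the G-an2-4 formalisation swarm seat
b2b-balaban-gan24-formalise-leaf-06, gen 7, welcomed by the plug's author asym1-g22).  HONEST FRAMING (cell contract, verbatim): «discharging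
`BetaPertH` makes Bałaban's UV stability UNCONDITIONAL — a real constructive-QFT result; it is NOT the continuum limit and NOT the Clay problem.»
HONEST DEPENDENCY (verbatim): «continuum YM on T⁴ ⇐ BetaPertH ∧ nine spine estimates (0/9 proved); BetaPertH ⇐ (D1) ∧ (D4) ∧ CAP+tail; G-an2-4
gates asym, D1 and NE2/3/4.»  [folklore] bookkeeping: composition BY NAME of `HessKerConvCKPlug.d1Drift_JsBalOf_iff_of_convCKWall` (p204118: K-rows
from `ConvCKWall 3 Lc`, S-∕W-rows hypotheses, rate ∕ window merge inside), `KSlotAssembly.convCKWall_holds` (p204341) and `StencilSlotOfE3.hS_of_e3` ∕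
`hSall_of_e3` (p204906); the only glue is that the wall asks `hS` and `hSall` at ONE common decay rate `δS`, while the two ENDs each produce their
own — merged by `min` (`hS_hSall_of_e3`; generic-`d` form `hS_hSall_of_shapes`).  No estimate, no cited fact, no `def`, no `Prop` mirror.
The located remainder of the S-slot enters as the INLINE HYPOTHESES `hE3` («E3Shape») and `hE3d` («E3Drift», member-pair shape at a ratio
`θ₃ ∈ (0,1)`; the ONE-STEP shape implies it, `e3Drift_pairs_of_step`) — the `j`-uniform bi-localisation and geometric drift of the normalised
value-function third jet `e3Of` of an2's composites; NOT IN PRINT for the typed objects (design note `HOME/b2b-balaban-gan24-p1/SKELETON-S3.md`),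
asserted nowhere — and the second-order rows `(hW, hWall)` (an2 work-order (P4)) stay hypotheses; the identification is the open side of the `↔`.
WHAT THIS BUYS: the wall's binder list {K-rows, S-rows, W-rows, window, ratio} is CUT DOWN, in the kernel, to {«E3Shape», «E3Drift», W-rows} for
`d = 3`, `2 ≤ Lc`, in ONE named statement.  NOTHING ELSE: (hW, hWall) NOT discharged, «E3Shape»∕«E3Drift» NOT proved, identification (O-asym1-7 ∕
row D1) open; NOT BetaPertH, NOT continuum, NOT Clay.  SCOPE NOTE (asym1-g22, X-an2-45 ∕ (R45), β-LEAD ruling pending): like every `JsBalOf`-literal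
corollary, §2 is TRUE AS STATED over an2's literal family; should the ruling re-place the spine Hessian (the `♮`-twins), the twin of §2 is mechanical
(`HessKerConvCKPlug` §1 and `HessKerFourFamily.d1Drift_iff_of_cauchy_four` apply verbatim) and is NOT written here.

## What is proved
* §1 (generic `d`) `e3Drift_pairs_of_step` (ONE-STEP drift of the normalised third-jet summands ⟹ the member-pair drift «E3Drift» consumed by
  `StencilSlotCauchyOfShapes.hSall_of_shapes`, constant `c/(1−θ)`; `HessKerDressedStep.locStencil_allScales_of_step`), **`hS_hSall_of_shapes`** (the
  S-slot's two ENDs `hS_of_shapes` ∕ `hSall_of_shapes` at ONE common rate `δS`: the literal PAIR `(hS, hSall)` of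
  `HessKerDressedUnitsWall.d1Drift_JsBalOf_iff_of_cauchy_unit` at `sf := sfStep Lc`, `sm := smStep d Lc`).
* §2 (`d = 3`) **`d1Drift_JsBalOf_iff_of_convCKWall_e3Shapes`** (`1 ≤ Lc`, the K-slot's wall form `ConvCKWall 3 Lc` as a HYPOTHESIS — its ratio
  `θK ∈ [0,1)` hidden in the existential is merged with the located drift's `θ₃ ∈ (0,1)` at `max θK θ₃` by the owner's
  `StencilSlotOfE3.cauchyDecayK_mono_theta`): «E3Shape» `→` «E3Drift» `→ (hW, hWall) →` (the D1 wall ⟺ the identification);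
  (`2 ≤ Lc`) **`hS_hSall_of_e3`** (the owner's `hS_of_e3` ∧ `hSall_of_e3` at ONE common `δS`, with the merged ratio `θ ∈ [0,1)`) and
  **`d1Drift_JsBalOf_iff_of_e3Shapes`**: «E3Shape» `→` «E3Drift» (`0 < θ₃ < 1`, `0 < δ₃`) `→ (hW, hWall)` (`θW ∈ [0,1)`, `0 < δW`) `→ ∀ μ ν N`,
  (the D1 wall `D1Drift Lc (JsBalOf …) N μ ν` ⟺ the identification at the axially dressed constructed limits of the rescaled primitives) — the
  K-slot DISCHARGED by `KSlotAssembly.convCKWall_holds`.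
HEADLINE DISCIPLINE (row owner's ruling): «the wall's binder list for `d = 3`, `2 ≤ Lc` reads {«E3Shape», «E3Drift», hW, hWall, window, identification}»
— never «S-slot closed».

## v1.1 (append-only): the «E3Drift» binder itself supplied from «E3Shape» ∧ «E3SupRate»
With the row owner's `GAN24/StencilSlotSupRate.e3Drift_of_shape_supRate` (p205023; finding F-gan24p1-3, `SKELETON-S3.md` §9; ref2 ROUND 29 RULING R29-1:
the re-cut PRESERVES the wall binder by type) the member-pair drift «E3Drift» is a kernel function of «E3Shape» and the ONE-STEP SUP-NORM rate
«E3SupRate» (`∀ j κ u, SupBound (Ẽ (j+2) κ u − Ẽ (j+1) κ u) (c·θ^j)`, `0 ≤ c`, `0 < θ < 1`; drift constant `√(2(c/(1−θ))C₃)·(√θ)^k` at rate `δ₃/2`).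
§3 **`d1Drift_JsBalOf_iff_of_e3Shape_supRate`** (`2 ≤ Lc`): «E3Shape» `→` «E3SupRate» `→ (hW, hWall) →` (the D1 wall ⟺ the identification) — §2 fed with
«E3Shape» at `δ₃/2` (`locStencil_mono'`) and «E3Drift» := `e3Drift_of_shape_supRate` at ratio `√θ ∈ (0,1)`.  Binder list for `d = 3`, `2 ≤ Lc` then reads
{«E3Shape», «E3SupRate», hW, hWall, window, identification} (ref2 r29 (d): `c`, `θ` outside `∀ j`, `0 < θ < 1` — a `θ = 0` supplier bumps `θ` first by the
monotonicity of `SupBound … (c·θ^j)` in `θ`).  Still NOTHING discharged; never «S-slot closed».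
-/

noncomputable section

open Literature.MathematicalPhysics.QuantumFieldTheory
open Literature.MathematicalPhysics.QuantumFieldTheory.Balaban1983to89
open Literature.MathematicalPhysics.QuantumFieldTheory.Balaban1983to89.Beta
open ExpKernelCalculus (MKer Decays BiLoc VertexFamily₂ hessKer)
open OneStepResolventKernel (Fib LocStencil)
open OneStepKernelFamily (KInvStep D1Drift)
open AxialDressing (axDressK axVertexOfK)
open StepJetData (mfNeg)
open BalabanStepJetsSucc (wE e3Of JsBal0Of JsBalOf)
open HessKerDressedLimit (limMKerOf limStOf limTabOf)
open Summit.QuantumFields.BalabanUV.Beta.HessKerDressedUnits (unitK unitS unitW)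
open Summit.QuantumFields.BalabanUV.Beta.HessKerDressedStep (locStencil_allScales_of_step)
open Summit.QuantumFields.BalabanUV.Beta.HessKerConvCKPlug (d1Drift_JsBalOf_iff_of_convCKWall)
open Summit.QuantumFields.BalabanUV.Beta.GAN24.CombesThomas (sfStep smStep UnitDecayK CauchyDecayK ConvCKWall SupBound sqrt_rate_lt_one)
open Summit.QuantumFields.BalabanUV.Beta.GAN24.KSlotAssembly (convCKWall_holds)
open Summit.QuantumFields.BalabanUV.Beta.GAN24.StencilSlotOfShapes (locStencil_mono' hS_of_shapes)
open Summit.QuantumFields.BalabanUV.Beta.GAN24.StencilSlotCauchyOfShapes (hSall_of_shapes)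
open Summit.QuantumFields.BalabanUV.Beta.GAN24.StencilSlotOfE3 (cauchyDecayK_mono_theta one_le_of_two_le hS_of_e3 hSall_of_e3)
open Summit.QuantumFields.BalabanUV.Beta.GAN24.StencilSlotSupRate (e3Drift_of_shape_supRate)

namespace Summit.QuantumFields.BalabanUV.Beta.GAN24.StencilSlotWallPlug

variable {d : ℕ}

/-! ## §1 Generic `d`: one-step ⟹ member pairs; the S-slot's two ENDs at one common rate -/

/-- [folklore] **ONE-STEP «E3Drift» ⟹ MEMBER-PAIR «E3Drift»**: if the normalised third-jet summands `P (k+1)` (members `≥ 1`) have one-step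
drift `c·θ^k` at rate `δ`, then the members `k+j+1` and `k+1` differ by at most `(c/(1−θ))·θ^k` at rate `δ`
(`HessKerDressedStep.locStencil_allScales_of_step` on the shifted sequence `k ↦ P (k+1)`). -/
theorem e3Drift_pairs_of_step {P : ℕ → Fin (d + 1) → (Fin (d + 1) → ℤ) → MKer (d + 1) (Fib d)} {c θ δ : ℝ}
    (h : ∀ k, LocStencil (fun κ u => P (k + 2) κ u - P (k + 1) κ u) (c * θ ^ k) δ) (hθ0 : 0 ≤ θ) (hθ1 : θ < 1) (k j : ℕ) :
    LocStencil (fun κ u => P (k + j + 1) κ u - P (k + 1) κ u) (c / (1 - θ) * θ ^ k) δ := by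
  have h' : ∀ k, LocStencil ((fun n => P (n + 1)) (k + 1) - (fun n => P (n + 1)) k) (c * θ ^ k) δ :=
    fun k κ u => (h k) κ u
  have h'' := locStencil_allScales_of_step (S := fun n => P (n + 1)) h' hθ0 hθ1 k j
  exact fun κ u => h'' κ u

section Family

variable {Lc : ℕ} [NeZero Lc]

/-- **THE S-SLOT's TWO ENDs AT ONE COMMON RATE** [folklore assembly, generic `d`]: from the K-slot's wall form (`UnitDecayK … C δ`,
`CauchyDecayK … cK θ δ`, `0 < δ`, `0 < θ`) and the located shapes «E3Shape» (`hE3`), «E3Drift» (`hE3d`, ratio `θ`), `0 < δ₃`, for ANY second-order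
tables `W`: `∃ Cs cS δS, 0 < δS ∧ (∀ j, LocStencil (unitS_j (JsBal0Of … j).S) Cs δS) ∧ (∀ k j, LocStencil (unitS_{k+j} (JsBal0Of … (k+j)).S −
unitS_k (JsBal0Of … k).S) (cS·θ^k) δS)` — LITERALLY the PAIR `(hS, hSall)` of `HessKerDressedUnitsWall.d1Drift_JsBalOf_iff_of_cauchy_unit` at
`sf := sfStep Lc`, `sm := smStep d Lc`, which asks both at the SAME `δS` (`hS_of_shapes`, `hSall_of_shapes`; rates merged by `min`). -/
theorem hS_hSall_of_shapes (hLc : 1 ≤ Lc) {C cK θ δ : ℝ} (hK : UnitDecayK d Lc (sfStep Lc) (smStep d Lc) C δ)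
    (hKall : CauchyDecayK d Lc (sfStep Lc) (smStep d Lc) cK θ δ) (hδ : 0 < δ) (hθ : 0 < θ) {cE cVH cΛ C₃ c₃ δ₃ : ℝ}
    (hE3 : ∀ j : ℕ, LocStencil (unitS (sfStep Lc (j + 1)) (smStep d Lc (j + 1))
      (fun κ u => (cE * wE d Lc (j + 1)) • e3Of d Lc cE cVH cΛ (j + 1) κ u)) C₃ δ₃)
    (hE3d : ∀ k j : ℕ, LocStencil (fun κ u =>
        unitS (sfStep Lc (k + j + 1)) (smStep d Lc (k + j + 1))
            (fun κ u => (cE * wE d Lc (k + j + 1)) • e3Of d Lc cE cVH cΛ (k + j + 1) κ u) κ u -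
          unitS (sfStep Lc (k + 1)) (smStep d Lc (k + 1))
            (fun κ u => (cE * wE d Lc (k + 1)) • e3Of d Lc cE cVH cΛ (k + 1) κ u) κ u) (c₃ * θ ^ k) δ₃)
    (hδ₃ : 0 < δ₃)
    (W : ℕ → Fin (d + 1) → (Fin (d + 1) → ℤ) → Fin (d + 1) → (Fin (d + 1) → ℤ) → MKer (d + 1) (Fib d))
    (Cw δw : ℕ → ℝ) (hδw : ∀ j, 0 < δw j) (hW : ∀ j, VertexFamily₂ (W j) Lc (Cw j) (δw j)) :
    ∃ Cs cS δS : ℝ, 0 < δS ∧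
      (∀ j, LocStencil (unitS (sfStep Lc j) (smStep d Lc j) (JsBal0Of hLc cE cVH cΛ W Cw δw hδw hW j).S) Cs δS) ∧
      (∀ k j, LocStencil (unitS (sfStep Lc (k + j)) (smStep d Lc (k + j)) (JsBal0Of hLc cE cVH cΛ W Cw δw hδw hW (k + j)).S -
        unitS (sfStep Lc k) (smStep d Lc k) (JsBal0Of hLc cE cVH cΛ W Cw δw hδw hW k).S) (cS * θ ^ k) δS) := by
  obtain ⟨Cs, δ₁, hδ₁, hS⟩ := hS_of_shapes (d := d) hLc hK hδ hE3 hδ₃ W Cw δw hδw hW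
  obtain ⟨cS, δ₂, hδ₂, hSall⟩ := hSall_of_shapes (d := d) hLc hK hKall hδ hθ hE3 hE3d hδ₃ W Cw δw hδw hW
  exact ⟨Cs, cS, min δ₁ δ₂, lt_min hδ₁ hδ₂, fun j => locStencil_mono' (hS j) le_rfl (min_le_left _ _), fun k j =>
    locStencil_mono' (hSall k j) le_rfl (min_le_right _ _)⟩

end Family

/-! ## §2 Dimension four: the D1 wall ⟺ the identification, given only the located third-jet shapes and the second-order rows -/

section WallHyp

variable {Lc : ℕ} [NeZero Lc] (hLc : 1 ≤ Lc) (cE cVH cΛ : ℝ)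
  (W : ℕ → Fin (3 + 1) → (Fin (3 + 1) → ℤ) → Fin (3 + 1) → (Fin (3 + 1) → ℤ) → MKer (3 + 1) (Fib 3))
  (Cw' δw : ℕ → ℝ) (hδw : ∀ j, 0 < δw j) (hW' : ∀ j, VertexFamily₂ (W j) Lc (Cw' j) (δw j))
  {C₃ c₃ θ₃ δ₃ Cw cW δW θW : ℝ}

/-- **THE D1 WALL ⟺ THE IDENTIFICATION FROM THE K-SLOT's WALL FORM `ConvCKWall 3 Lc` (HYPOTHESIS), THE TWO LOCATED THIRD-JET SHAPES AND THE
SECOND-ORDER ROWS** [folklore assembly]: the K-slot's ratio `θK ∈ [0,1)` (inside the existential) and the located drift's `θ₃ ∈ (0,1)` are merged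
at `max θK θ₃ > 0` (`StencilSlotOfE3.cauchyDecayK_mono_theta`; the drift bound only grows with the ratio), the S-rows come from `hS_hSall_of_shapes`
(`d = 3`) at one `δS`, and asym1's `HessKerConvCKPlug.d1Drift_JsBalOf_iff_of_convCKWall` does the rest (its own rate ∕ window merge inside).
Discharges NOTHING beyond the composition; for `2 ≤ Lc` the hypothesis `h` is `KSlotAssembly.convCKWall_holds` (next theorem). -/
theorem d1Drift_JsBalOf_iff_of_convCKWall_e3Shapes (h : ConvCKWall 3 Lc)
    (hE3 : ∀ j : ℕ, LocStencil (unitS (sfStep Lc (j + 1)) (smStep 3 Lc (j + 1))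
      (fun κ u => (cE * wE 3 Lc (j + 1)) • e3Of 3 Lc cE cVH cΛ (j + 1) κ u)) C₃ δ₃)
    (hE3d : ∀ k j : ℕ, LocStencil (fun κ u =>
        unitS (sfStep Lc (k + j + 1)) (smStep 3 Lc (k + j + 1))
            (fun κ u => (cE * wE 3 Lc (k + j + 1)) • e3Of 3 Lc cE cVH cΛ (k + j + 1) κ u) κ u -
          unitS (sfStep Lc (k + 1)) (smStep 3 Lc (k + 1))
            (fun κ u => (cE * wE 3 Lc (k + 1)) • e3Of 3 Lc cE cVH cΛ (k + 1) κ u) κ u) (c₃ * θ₃ ^ k) δ₃)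
    (hθ₃ : 0 < θ₃) (hθ₃1 : θ₃ < 1) (hδ₃ : 0 < δ₃)
    (hW : ∀ j, VertexFamily₂ (unitW (sfStep Lc j) (smStep 3 Lc j) (W j)) Lc Cw δW)
    (hWall : ∀ k j, VertexFamily₂ (unitW (sfStep Lc (k + j)) (smStep 3 Lc (k + j)) (W (k + j)) -
      unitW (sfStep Lc k) (smStep 3 Lc k) (W k)) Lc (cW * θW ^ k) δW)
    (hδW : 0 < δW) (hθW0 : 0 ≤ θW) (hθW1 : θW < 1) (μ ν : Fin 4) (N : ℝ) :
    D1Drift Lc (JsBalOf hLc cE cVH cΛ W Cw' δw hδw hW') N μ ν ↔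
      B12Beta.secondMoment (hessKer (axDressK Lc (limMKerOf fun j => unitK (sfStep Lc j) (smStep 3 Lc j) (KInvStep (d := 3) Lc j)))
        (axVertexOfK (limMKerOf fun j => unitK (sfStep Lc j) (smStep 3 Lc j) (KInvStep (d := 3) Lc j)) Lc
          (limStOf fun j => unitS (sfStep Lc j) (smStep 3 Lc j) (JsBal0Of hLc cE cVH cΛ W Cw' δw hδw hW' j).S))
        (limTabOf fun j => unitW (sfStep Lc j) (smStep 3 Lc j) (W j))) μ ν = B12Normalization.stepBal N Lc := by
  obtain ⟨C, δK, cK, θK, hδK, hθK0, hθK1, hK, hKall⟩ := h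
  -- merge the K-slot's ratio with the located drift's at θ = max θK θ₃ ∈ (0, 1)
  set θ : ℝ := max θK θ₃ with hθdef
  have hθ0 : 0 < θ := lt_of_lt_of_le hθ₃ (le_max_right _ _)
  have hθ1 : θ < 1 := max_lt hθK1 hθ₃1
  have hKall' : CauchyDecayK 3 Lc (sfStep Lc) (smStep 3 Lc) cK θ δK := cauchyDecayK_mono_theta hKall hθK0 (le_max_left _ _)
  have hc₃ : 0 ≤ c₃ := by
    have h0 := ((hE3d 0 0) 0 0).nonneg (Sum.inl 0)
    simpa using h0
  have hE3d' : ∀ k j : ℕ, LocStencil (fun κ u =>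
      unitS (sfStep Lc (k + j + 1)) (smStep 3 Lc (k + j + 1))
          (fun κ u => (cE * wE 3 Lc (k + j + 1)) • e3Of 3 Lc cE cVH cΛ (k + j + 1) κ u) κ u -
        unitS (sfStep Lc (k + 1)) (smStep 3 Lc (k + 1))
          (fun κ u => (cE * wE 3 Lc (k + 1)) • e3Of 3 Lc cE cVH cΛ (k + 1) κ u) κ u) (c₃ * θ ^ k) δ₃ := by
    intro k j κ u x y a b
    refine ((hE3d k j) κ u x y a b).trans (mul_le_mul_of_nonneg_right ?_ (Real.exp_pos _).le)
    exact mul_le_mul_of_nonneg_left (pow_le_pow_left₀ hθ₃.le (le_max_right _ _) k) hc₃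
  obtain ⟨Cs, cS, δS, hδS, hS, hSall⟩ :=
    hS_hSall_of_shapes (d := 3) hLc hK hKall' hδK hθ0 hE3 hE3d' hδ₃ W Cw' δw hδw hW'
  exact d1Drift_JsBalOf_iff_of_convCKWall hLc cE cVH cΛ W Cw' δw hδw hW' ⟨C, δK, cK, θK, hδK, hθK0, hθK1, hK, hKall⟩ hS hSall hW
    hWall hδS hδW hθ0.le hθ1 hθW0 hθW1 μ ν N

end WallHyp

section Wall

variable {Lc : ℕ} [NeZero Lc] (hLc : 2 ≤ Lc) (cE cVH cΛ : ℝ)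
  (W : ℕ → Fin (3 + 1) → (Fin (3 + 1) → ℤ) → Fin (3 + 1) → (Fin (3 + 1) → ℤ) → MKer (3 + 1) (Fib 3))
  (Cw' δw : ℕ → ℝ) (hδw : ∀ j, 0 < δw j) (hW' : ∀ j, VertexFamily₂ (W j) Lc (Cw' j) (δw j))
  {C₃ c₃ θ₃ δ₃ Cw cW δW θW : ℝ}

/-- **THE S-ROWS OF THE WALL FROM THE LOCATED SHAPES ALONE, AT ONE COMMON RATE** (`d = 3`, `2 ≤ Lc`) [folklore]: the row owner's
`StencilSlotOfE3.hS_of_e3` and `hSall_of_e3` (K-slot discharged inside by `KSlotAssembly.convCKWall_holds`), their two decay rates merged by `min`: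
`∃ Cs cS θ δS, 0 ≤ θ ∧ θ < 1 ∧ 0 < δS ∧ hS(Cs, δS) ∧ hSall(cS·θ^k, δS)`. -/
theorem hS_hSall_of_e3
    (hE3 : ∀ j : ℕ, LocStencil (unitS (sfStep Lc (j + 1)) (smStep 3 Lc (j + 1))
      (fun κ u => (cE * wE 3 Lc (j + 1)) • e3Of 3 Lc cE cVH cΛ (j + 1) κ u)) C₃ δ₃)
    (hE3d : ∀ k j : ℕ, LocStencil (fun κ u =>
        unitS (sfStep Lc (k + j + 1)) (smStep 3 Lc (k + j + 1))
            (fun κ u => (cE * wE 3 Lc (k + j + 1)) • e3Of 3 Lc cE cVH cΛ (k + j + 1) κ u) κ u -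
          unitS (sfStep Lc (k + 1)) (smStep 3 Lc (k + 1))
            (fun κ u => (cE * wE 3 Lc (k + 1)) • e3Of 3 Lc cE cVH cΛ (k + 1) κ u) κ u) (c₃ * θ₃ ^ k) δ₃)
    (hθ₃ : 0 < θ₃) (hθ₃1 : θ₃ < 1) (hδ₃ : 0 < δ₃) :
    ∃ Cs cS θ δS : ℝ, 0 ≤ θ ∧ θ < 1 ∧ 0 < δS ∧
      (∀ j, LocStencil (unitS (sfStep Lc j) (smStep 3 Lc j) (JsBal0Of (one_le_of_two_le hLc) cE cVH cΛ W Cw' δw hδw hW' j).S) Cs δS) ∧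
      (∀ k j, LocStencil (unitS (sfStep Lc (k + j)) (smStep 3 Lc (k + j))
          (JsBal0Of (one_le_of_two_le hLc) cE cVH cΛ W Cw' δw hδw hW' (k + j)).S -
        unitS (sfStep Lc k) (smStep 3 Lc k) (JsBal0Of (one_le_of_two_le hLc) cE cVH cΛ W Cw' δw hδw hW' k).S) (cS * θ ^ k) δS) := by
  obtain ⟨Cs, δ₁, hδ₁, hS⟩ := hS_of_e3 (Lc := Lc) hLc hE3 hδ₃ W Cw' δw hδw hW'
  obtain ⟨cS, θ, δ₂, hθ0, hθ1, hδ₂, hSall⟩ := hSall_of_e3 (Lc := Lc) hLc hE3 hE3d hθ₃ hθ₃1 hδ₃ W Cw' δw hδw hW'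
  exact ⟨Cs, cS, θ, min δ₁ δ₂, hθ0, hθ1, lt_min hδ₁ hδ₂, fun j => locStencil_mono' (hS j) le_rfl (min_le_left _ _), fun k j =>
    locStencil_mono' (hSall k j) le_rfl (min_le_right _ _)⟩

/-- **THE D1 WALL ⟺ THE IDENTIFICATION FOR `2 ≤ Lc`, FROM THE TWO LOCATED THIRD-JET SHAPES AND THE SECOND-ORDER ROWS ONLY** [folklore
assembly]: asym1's `HessKerConvCKPlug.d1Drift_JsBalOf_iff_of_convCKWall` with its K-hypothesis DISCHARGED by road P1's `KSlotAssembly.convCKWall_holds`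
and its S-rows SUPPLIED by the S-slot ENDs (`d1Drift_JsBalOf_iff_of_convCKWall_e3Shapes`; equivalently `hS_hSall_of_e3`); the W-rows `(hW, hWall)` (ratio `θW ∈ [0,1)`, `0 < δW`) stay hypotheses; rates, ratios and the window are
merged inside asym1's plug.  REMAINING BINDERS, verbatim: «E3Shape», «E3Drift» (the S-slot's located third-jet summand), `(hW, hWall)` (an2 (P4));
the identification is the open side of the `↔` (O-asym1-7 ∕ row D1).  NOT BetaPertH, NOT continuum, NOT Clay. -/
theorem d1Drift_JsBalOf_iff_of_e3Shapes
    (hE3 : ∀ j : ℕ, LocStencil (unitS (sfStep Lc (j + 1)) (smStep 3 Lc (j + 1))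
      (fun κ u => (cE * wE 3 Lc (j + 1)) • e3Of 3 Lc cE cVH cΛ (j + 1) κ u)) C₃ δ₃)
    (hE3d : ∀ k j : ℕ, LocStencil (fun κ u =>
        unitS (sfStep Lc (k + j + 1)) (smStep 3 Lc (k + j + 1))
            (fun κ u => (cE * wE 3 Lc (k + j + 1)) • e3Of 3 Lc cE cVH cΛ (k + j + 1) κ u) κ u -
          unitS (sfStep Lc (k + 1)) (smStep 3 Lc (k + 1))
            (fun κ u => (cE * wE 3 Lc (k + 1)) • e3Of 3 Lc cE cVH cΛ (k + 1) κ u) κ u) (c₃ * θ₃ ^ k) δ₃)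
    (hθ₃ : 0 < θ₃) (hθ₃1 : θ₃ < 1) (hδ₃ : 0 < δ₃)
    (hW : ∀ j, VertexFamily₂ (unitW (sfStep Lc j) (smStep 3 Lc j) (W j)) Lc Cw δW)
    (hWall : ∀ k j, VertexFamily₂ (unitW (sfStep Lc (k + j)) (smStep 3 Lc (k + j)) (W (k + j)) -
      unitW (sfStep Lc k) (smStep 3 Lc k) (W k)) Lc (cW * θW ^ k) δW)
    (hδW : 0 < δW) (hθW0 : 0 ≤ θW) (hθW1 : θW < 1) (μ ν : Fin 4) (N : ℝ) :
    D1Drift Lc (JsBalOf (one_le_of_two_le hLc) cE cVH cΛ W Cw' δw hδw hW') N μ ν ↔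
      B12Beta.secondMoment (hessKer (axDressK Lc (limMKerOf fun j => unitK (sfStep Lc j) (smStep 3 Lc j) (KInvStep (d := 3) Lc j)))
        (axVertexOfK (limMKerOf fun j => unitK (sfStep Lc j) (smStep 3 Lc j) (KInvStep (d := 3) Lc j)) Lc
          (limStOf fun j => unitS (sfStep Lc j) (smStep 3 Lc j) (JsBal0Of (one_le_of_two_le hLc) cE cVH cΛ W Cw' δw hδw hW' j).S))
        (limTabOf fun j => unitW (sfStep Lc j) (smStep 3 Lc j) (W j))) μ ν = B12Normalization.stepBal N Lc :=
  d1Drift_JsBalOf_iff_of_convCKWall_e3Shapes (one_le_of_two_le hLc) cE cVH cΛ W Cw' δw hδw hW' (convCKWall_holds hLc) hE3 hE3d hθ₃ hθ₃1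
    hδ₃ hW hWall hδW hθW0 hθW1 μ ν N

end Wall

/-! ## §3 (v1.1) Dimension four, `2 ≤ Lc`: the «E3Drift» binder supplied from «E3Shape» ∧ «E3SupRate» (`StencilSlotSupRate`) -/

section WallSupRate

variable {Lc : ℕ} [NeZero Lc] (hLc : 2 ≤ Lc) (cE cVH cΛ : ℝ)
  (W : ℕ → Fin (3 + 1) → (Fin (3 + 1) → ℤ) → Fin (3 + 1) → (Fin (3 + 1) → ℤ) → MKer (3 + 1) (Fib 3))
  (Cw' δw : ℕ → ℝ) (hδw : ∀ j, 0 < δw j) (hW' : ∀ j, VertexFamily₂ (W j) Lc (Cw' j) (δw j))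
  {C₃ δ₃ c θ Cw cW δW θW : ℝ}

/-- **THE D1 WALL ⟺ THE IDENTIFICATION FOR `2 ≤ Lc`, FROM «E3Shape», THE ONE-STEP SUP-NORM RATE «E3SupRate» AND THE SECOND-ORDER ROWS ONLY**
[folklore assembly, v1.1]: `d1Drift_JsBalOf_iff_of_e3Shapes` with «E3Shape» read at the rate `δ₃/2` (`StencilSlotOfShapes.locStencil_mono'`) and its
«E3Drift» binder SUPPLIED by the row owner's `StencilSlotSupRate.e3Drift_of_shape_supRate` (drift constant `√(2(c/(1−θ))C₃)`, ratio `√θ ∈ (0,1)` —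
`Real.sqrt_pos`, `CombesThomas.sqrt_rate_lt_one` —, rate `δ₃/2`).  REMAINING BINDERS, verbatim: «E3Shape» (`C₃`, `δ₃ > 0`, `j`-free, member `j+1`),
«E3SupRate» (`0 ≤ c`, `0 < θ < 1`, outside `∀ j`), `(hW, hWall)` (an2 (P4)); the identification is the open side of the `↔` (O-asym1-7 ∕ row D1).
Discharges NOTHING beyond the composition; NOT BetaPertH, NOT continuum, NOT Clay. -/
theorem d1Drift_JsBalOf_iff_of_e3Shape_supRate
    (hE3 : ∀ j : ℕ, LocStencil (unitS (sfStep Lc (j + 1)) (smStep 3 Lc (j + 1))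
      (fun κ u => (cE * wE 3 Lc (j + 1)) • e3Of 3 Lc cE cVH cΛ (j + 1) κ u)) C₃ δ₃)
    (hR : ∀ (j : ℕ) (κ : Fin (3 + 1)) (u : Fin (3 + 1) → ℤ),
      SupBound (unitS (sfStep Lc (j + 2)) (smStep 3 Lc (j + 2)) (fun κ u => (cE * wE 3 Lc (j + 2)) • e3Of 3 Lc cE cVH cΛ (j + 2) κ u) κ u -
        unitS (sfStep Lc (j + 1)) (smStep 3 Lc (j + 1)) (fun κ u => (cE * wE 3 Lc (j + 1)) • e3Of 3 Lc cE cVH cΛ (j + 1) κ u) κ u) (c * θ ^ j))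
    (hc : 0 ≤ c) (hθ0 : 0 < θ) (hθ1 : θ < 1) (hδ₃ : 0 < δ₃)
    (hW : ∀ j, VertexFamily₂ (unitW (sfStep Lc j) (smStep 3 Lc j) (W j)) Lc Cw δW)
    (hWall : ∀ k j, VertexFamily₂ (unitW (sfStep Lc (k + j)) (smStep 3 Lc (k + j)) (W (k + j)) -
      unitW (sfStep Lc k) (smStep 3 Lc k) (W k)) Lc (cW * θW ^ k) δW)
    (hδW : 0 < δW) (hθW0 : 0 ≤ θW) (hθW1 : θW < 1) (μ ν : Fin 4) (N : ℝ) :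
    D1Drift Lc (JsBalOf (one_le_of_two_le hLc) cE cVH cΛ W Cw' δw hδw hW') N μ ν ↔
      B12Beta.secondMoment (hessKer (axDressK Lc (limMKerOf fun j => unitK (sfStep Lc j) (smStep 3 Lc j) (KInvStep (d := 3) Lc j)))
        (axVertexOfK (limMKerOf fun j => unitK (sfStep Lc j) (smStep 3 Lc j) (KInvStep (d := 3) Lc j)) Lc
          (limStOf fun j => unitS (sfStep Lc j) (smStep 3 Lc j) (JsBal0Of (one_le_of_two_le hLc) cE cVH cΛ W Cw' δw hδw hW' j).S))
        (limTabOf fun j => unitW (sfStep Lc j) (smStep 3 Lc j) (W j))) μ ν = B12Normalization.stepBal N Lc :=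
  d1Drift_JsBalOf_iff_of_e3Shapes hLc cE cVH cΛ W Cw' δw hδw hW'
    (fun j => locStencil_mono' (hE3 j) le_rfl (by linarith : δ₃ / 2 ≤ δ₃))
    (e3Drift_of_shape_supRate (d := 3) hE3 hR hc hθ0.le hθ1) (Real.sqrt_pos.2 hθ0) (sqrt_rate_lt_one hθ1) (half_pos hδ₃)
    hW hWall hδW hθW0 hθW1 μ ν N

end WallSupRate

end Summit.QuantumFields.BalabanUV.Beta.GAN24.StencilSlotWallPlug

end
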